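/-
Copyright (c) 2026 the pub-hodgecm-mathlib formalisation cell (harness21).  Prover seat hodgecm-mathlib-K2Liu-p26 (g0): Track B «K2-LIT»,
#184♮ = hLiu418 = stmt-HodgeConjecture-24832; #42S organ S1, (G) organ ROW (ρ-mid), step (M2a-C2a): THE TENSOR DATUM'S MIDDLE-CELL VALUES AS AN
EXPLICIT `X₁`-INTEGRAL — ★ (M1) `swSectionTensorLoc_flip_mul_nElem_eq_block` ∘ ★∕📤 (M2a-C1) `K2LiuBlockMiddleCellHaarDelta` (desk K2Liu-p01 (g10) 15:55:39Z; cut 15:57Z).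
-/
import Summits.HodgeConjecture.HodgeConjecture.Theorems.K2LiuLocalSWTensorMiddleCellTransport   -- ★ (M1) `swSectionTensorLoc_flip_mul_nElem_eq_block`, `map_proj_frameMp_symm_of_mover`
import Summits.HodgeConjecture.HodgeConjecture.Theorems.K2LiuBlockMiddleCellHaarDelta           -- ★ (M2a-C1) `exists_ne_zero_swSectionLoc_blkLoc_weylDelta_mul_nElem_eq_integral`
import HarnessLib

/-!
# Crux `HLiu418`, #42S organ S1, (G) organ ROW (ρ-mid), step (M2a-C2a): THE TENSOR DATUM'S MIDDLE CELL AS AN EXPLICIT INTEGRAL —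
# `F_Ψ(w₁ · n(t)) = c · ∫_{X₁} (unipOpPi c_{t′} (op(j̃(p₁,p₂)) (frameOp_{PD}⁻¹ Ψ)))(x₁ ⊔ 0) dx₁`, ONE `c ≠ 0` for all `t`, `Ψ`

Cell `hodgecm-mathlib`, crux item hLiu418 = `stmt-HodgeConjecture-24832`, route of record `HCCMUnconditional`; squad K2 ∕ K2Liu, road `K2_Liu`, socket #42S (a),
organ S1; LEAD F0P6-plan (g14), desk K2Liu-p01 (g10).  THEOREMS ONLY (no `def`, no `instance`, no `notation`, no named-fact hypothesis, no `sorry`); lane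
`--supports stmt-HodgeConjecture-24832` (count-neutral helper).

WHY.  The (G)-inert organ's assembly ★ `K2LiuInertWitnessOffBigCellAssembly.exists_mu_hf₀off_of_readings` wants the two middle-profile rows
`hfac± : F_{Φ_±}(w₁·x) = K_± · g(x)` (`x ∈ P_Δ`) for the lattice-pair witnesses `Φ_±` of the tensor data `Σ_{𝕍⊗V′_±}`.  Step (M1) (★ p861514) moved the
tensor datum's middle cell `w₁ · n(t)` to the block datum `Σ_{T₁ ⊕ᶠ T₂}` through the permutation frame `PD = P ⊕ P`; step (M2a-C1) (★∕📤 p861833) evaluated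
the block datum's middle cell at Kudla's implementer `j̃(p₁, p₂)` with the explicit functional `Haar_{X₁} ⊗ δ₀`.  THIS FILE composes the two (one `obtain`, one
`Eq.trans`; the outer implementer of (M2a-C1) is `frameMp_{PD}⁻¹ m₀`, a mover-implementer by ★ (M1) §1 `map_proj_frameMp_symm_of_mover`):
* **`exists_ne_zero_swSectionTensorLoc_flip_mul_nElem_eq_integral`** — with (M1)'s frame data (`σ`, `P`, `PD`, `T₁ ⊕ᶠ T₂ = diagonal t′`, the flip `w₁` of line
  `i₀`) and (M2a-C1)'s block data (`T₁ = diagonal t₁`, `0 < M₂`, Cayley-type `p₁` (`hW₁`), `p₂` over a mover, conductor exponent `m` of `ψ_v`), for ANY outer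
  mover-implementer `m₀` of the TENSOR datum: `∃ c ≠ 0, ∀ t t′ (hPX : P_v t′ P_v⁻¹ = reindex epsV (t ⊗ₖ 1)) Ψ,`
  `swSectionTensorLoc … m₀ Ψ (w₁ · n(t)) = c · ∫_{X₁} (unipOpPi c_{t′} (op(j̃(p₁,p₂)) (frameOp_{PD}⁻¹ Ψ)))(x₁ ⊔ 0) dμ^{⊗(M₂+M₂)}`.
  Consumer ((M2a-C2b), this seat): `Ψ := Φ_ε` the ★ (H4) witness built on the implementer `(E′_ε, Γ_ε) :=` the `PD`-frame transport of `j̃(p₁, p₂)`, so that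
  `op(j̃)(frameOp⁻¹ Φ_ε) = frameOp⁻¹ (Γ_ε Φ_ε) = frameOp⁻¹ (𝟙_{κ⁻¹B₁} − 𝟙_{κ⁻¹B₂})`; then the Levi step (M2a-C3), the κ∕(K1) reading ★ (M2a-L)
  `K2LiuWitnessLeviReading` (K2Liu-p01) and ★ (M2b) `K2LiuMiddleProfileFactorisation` give `hfac±`.
References: [Kudla1994] §3 Thm. 3.1; [Rangarao1993] Lemma 3.2 (3.8); [MoeglinVignerasWaldspurger1987] Chap. 2 II.1 Rem. (3), (6), II.6; [HarrisKudlaSweet1996] §1.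
HONEST LABEL.  Count-neutral helper; it retires nothing by itself: `HC_CM` is proved only modulo the 7 printed citations (2 remaining named inputs:
hLiu418 = `stmt-HodgeConjecture-24832`, h413 = `stmt-HodgeConjecture-24833`) until rung 0 closes.

## References
* [Kudla1994] S. S. Kudla, *Splitting metaplectic covers of dual reductive pairs*, Israel J. Math. 87 (1994), §3 Thm. 3.1.
* [Rangarao1993] R. Ranga Rao, *On some explicit formulas in the theory of Weil representation*, Pacific J. Math. 157 (1993), Lemma 3.2.
* [MoeglinVignerasWaldspurger1987] C. Mœglin, M.-F. Vignéras, J.-L. Waldspurger, LNM 1291 (1987), Chap. 2 II.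
* [HarrisKudlaSweet1996] M. Harris, S. Kudla, W. J. Sweet, J. Amer. Math. Soc. 9 (1996), §1.
-/

set_option autoImplicit false
set_option linter.dupNamespace false -- the mandated namespace repeats `HodgeConjecture.HodgeConjecture`

noncomputable section

open scoped Matrix Kronecker
open NumberField IsDedekindDomain MeasureTheory Matrix
open Literature.RepresentationTheory.HeisenbergGroup Literature.RepresentationTheory.HeisenbergGroup.SymplecticMatrix
open Literature.NumberTheory.Automorphic Literature.NumberTheory.Automorphic.UnitaryGroup Literature.NumberTheory.Weil1964
open Literature.NumberTheory.GaloisRepresentations Literature.NumberTheory.GaloisRepresentations.IsNonarchimedeanLocalField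
open Literature.RepresentationTheory.HarrisKudlaSweet1996
open Literature.NumberTheory.GelbartRogawski1991 Literature.NumberTheory.GelbartRogawski1991.GRConstruction
open Literature.NumberTheory.GelbartRogawski1991.AdaptedBlocks
open Literature.NumberTheory.GelbartRogawski1991.UnitaryDualPair
open Literature.NumberTheory.GelbartRogawski1991.UnitaryDualPair.LocalSplitting
open Literature.NumberTheory.GelbartRogawski1991.UnitaryDualPair.LocalSplitting.FrameTransport
open Literature.NumberTheory.GelbartRogawski1991.UnitaryDualPair.LocalSplitting.DoubledBlock
open Literature.NumberTheory.K2Lit.SiegelDoubled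
open Summit.HodgeConjecture.HodgeConjecture.Cruxes.HLiu418.K2LiuLocalSWSectionDefs
open Summit.HodgeConjecture.HodgeConjecture.Cruxes.HLiu418.K2LiuLocalSWTensorBlockTransport
open Summit.HodgeConjecture.HodgeConjecture.Cruxes.HLiu418.K2LiuLocalSWTensorBlockFrame
open Summit.HodgeConjecture.HodgeConjecture.Cruxes.HLiu418.K2LiuLocalSWTensorBigCellLetters
open Summit.HodgeConjecture.HodgeConjecture.Cruxes.HLiu418.K2LiuLocalSWTensorMiddleCellTransport
open Summit.HodgeConjecture.HodgeConjecture.Cruxes.HLiu418.K2LiuBlockMiddleCellHaarDelta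

namespace Summit.HodgeConjecture.HodgeConjecture.Cruxes.HLiu418.K2LiuTensorMiddleCellHaarDelta

variable (L : Type) [Field L] [NumberField L] [IsCMField L]
variable {N M : ℕ} (e : Fin N × Fin M ≃ Fin 2)
  (dV : Fin N → L) (hdV : ∀ i, IsCMField.complexConj L (dV i) = dV i)
  (dW : Fin M → L) (hdW : ∀ i, IsCMField.complexConj L (dW i) = dW i)
variable {M₂ M' : ℕ} (eW : Fin M × Fin M₂ ≃ Fin M') (e' : Fin N × Fin M' ≃ Fin (M₂ + M₂))
  (dV' : Fin M₂ → L) (hdV' : ∀ k, IsCMField.complexConj L (dV' k) = dV' k)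
  (v : HeightOneSpectrum (𝓞 (Fp L)))
  [MeasurableSpace (v.adicCompletion (Fp L))] [BorelSpace (v.adicCompletion (Fp L))]
  (μ : Measure (v.adicCompletion (Fp L))) [μ.IsAddHaarMeasure]
  (χ : HeckeCharacter L) (hχ : IsSplittingChar L 1 χ)

set_option maxHeartbeats 800000 in -- MEASURED: 400000 fails (`isDefEq` of the (M1) ∕ (M2a-C1) instances at `Eq.trans`), 800000 passes
/-- **(M2a-C2a) THE TENSOR DATUM'S MIDDLE CELL AS AN EXPLICIT `X₁`-INTEGRAL.**  With (M1)'s frame data (`n = 2`, lines `i₀ ≠ i₁`, block permutation `σ` with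
matrix `P`, `Pᵀ·gramR(𝕍⊗V′)·P = T₁ ⊕ᶠ T₂ = diagonal t′` invertible, `PD = P ⊕ P`, the flip `w₁` of line `i₀`) and (M2a-C1)'s block data (`0 < M₂`, `T₁ = diagonal t₁`,
`p₁` Cayley-type (`hW₁`), `p₂` over a mover, `ψ_v` of conductor exponent `m`), for ANY mover-implementer `m₀` of the tensor datum there is ONE `c ≠ 0` with, for
every skew `t`, every block-side skew `t′` with `P_v t′ P_v⁻¹ = reindex epsV (t ⊗ₖ 1)` and every `Ψ`,
`swSectionTensorLoc … m₀ Ψ (w₁ · n(t)) = c · ∫_{X₁} (unipOpPi c_{t′} (op(j̃(p₁,p₂)) (frameOp_{PD}⁻¹ Ψ)))(x₁ ⊔ 0) dμ^{⊗(M₂+M₂)}`, `c_{t′} = cOfFix 𝕋 (π(j̃) ι(n(t′)) π(j̃)⁻¹)`.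
[cite: Kudla1994, §3 Thm. 3.1] [cite: Rangarao1993, Lemma 3.2 (3.8), p. 351] [cite: MoeglinVignerasWaldspurger1987, Chap. 2 II.1 Rem. (3), (6), II.6] -/
theorem exists_ne_zero_swSectionTensorLoc_flip_mul_nElem_eq_integral (hM₂ : 0 < M₂ + M₂)
    (hT₀d : IsUnit (gramR L e' dV hdV (tensorFrame L dW eW dV') (tensorFrame_real L dW hdW eW dV' hdV')).det)
    {i₀ i₁ : Fin 2} (hi : i₀ ≠ i₁) {σ : Equiv.Perm (Fin (M₂ + M₂))}
    (hσ₀ : ∀ k, σ (epsV e eW e' (i₀, k)) = finSumFinEquiv (Sum.inl k)) (hσ₁ : ∀ k, σ (epsV e eW e' (i₁, k)) = finSumFinEquiv (Sum.inr k))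
    {T₁ T₂ : Matrix (Fin M₂) (Fin M₂) (Fp L)}
    (P : GL (Fin (M₂ + M₂)) (Fp L)) (hPσ : (P : Matrix (Fin (M₂ + M₂)) (Fin (M₂ + M₂)) (Fp L)) = σ.toPEquiv.toMatrix)
    (hP : ((P : Matrix (Fin (M₂ + M₂)) (Fin (M₂ + M₂)) (Fp L)))ᵀ *
        gramR L e' dV hdV (tensorFrame L dW eW dV') (tensorFrame_real L dW hdW eW dV' hdV') * (P : Matrix _ _ (Fp L)) =
      UnitaryGroup.finSum M₂ M₂ T₁ T₂)
    (t' : Fin (M₂ + M₂) → Fp L) (hT' : UnitaryGroup.finSum M₂ M₂ T₁ T₂ = Matrix.diagonal t') (hT₀'d : IsUnit (UnitaryGroup.finSum M₂ M₂ T₁ T₂).det)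
    {PD : GL (Fin ((M₂ + M₂) + (M₂ + M₂))) (Fp L)} (hPD : PD = UnitaryGroup.reindexGL (e₂ (M₂ + M₂)) (UnitaryGroup.blockDiagGL (P, P)))
    (m₀ : LocalMp (Fp L) ((M₂ + M₂) + (M₂ + M₂))
      (gramD (Fp L) (M₂ + M₂) (gramR L e' dV hdV (tensorFrame L dW eW dV') (tensorFrame_real L dW hdW eW dV' hdV'))) v)
    (hm₀ : (deltaLagrangian (Fp L) v (M₂ + M₂)).map (toLin (Fp L) v (MpPsi.proj _ m₀)) = lagrangianY (Fp L) ((M₂ + M₂) + (M₂ + M₂)) v)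
    {w₁ : UnitaryGroup.localPi L (IsCMField.complexConj L) (2 + 2) (hermD L e dV hdV dW hdW) v}
    (hw₁ : adapt (matA (Fp L) L (IsCMField.complexConj L) v 2 w₁) =
      Matrix.fromBlocks (1 - Matrix.single i₀ i₀ 1) (Matrix.single i₀ i₀ 1) (Matrix.single i₀ i₀ 1) (1 - Matrix.single i₀ i₀ 1))
    -- the block data of (M2a-C1)
    (hM₂' : 0 < M₂) (t₁ : Fin M₂ → Fp L) (hT₁t : T₁ = Matrix.diagonal t₁) (hT₁ : T₁.IsSymm) (hT₂ : T₂.IsSymm)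
    (hT₁d : IsUnit T₁.det) (hT₂d : IsUnit T₂.det)
    (hTv₁ : IsUnit (localGram (Fp L) (M₂ + M₂) (gramD (Fp L) M₂ T₁) v).det)
    (p₁ : LocalMp (Fp L) (M₂ + M₂) (gramD (Fp L) M₂ T₁) v)
    (hp₁ : (deltaLagrangian (Fp L) v M₂).map (toLin (Fp L) v (MpPsi.proj _ p₁)) = lagrangianY (Fp L) (M₂ + M₂) v)
    (B₁ : GL (Fin (M₂ + M₂)) (v.adicCompletion (Fp L)))
    (hW₁ : MpPsi.proj _ p₁ * iotaD (Fp L) L (IsCMField.complexConj L) (complexConj_imagUnit L) (imagUnit_ne_zero L)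
        (imagUnit_mul_self L) v M₂ hT₁ rfl (weylDelta (Fp L) L (IsCMField.complexConj L) v M₂ (T₀ := T₁) rfl) * (MpPsi.proj _ p₁)⁻¹ =
      (transportSp (localGram (Fp L) (M₂ + M₂) (gramD (Fp L) M₂ T₁) v) hTv₁ (SymplecticGroup.symJ _ _))⁻¹ *
        transportSp (localGram (Fp L) (M₂ + M₂) (gramD (Fp L) M₂ T₁) v) hTv₁ (levi B₁))
    {m : ℤ} (hm : (adeleAddCharAt (Fp L) v).HasConductorExp m)
    (p₂ : LocalMp (Fp L) (M₂ + M₂) (gramD (Fp L) M₂ T₂) v)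
    (hp₂ : (deltaLagrangian (Fp L) v M₂).map (toLin (Fp L) v (MpPsi.proj _ p₂)) = lagrangianY (Fp L) (M₂ + M₂) v) :
    ∃ c : ℂ, c ≠ 0 ∧ ∀ (t : Matrix (Fin 2) (Fin 2) (LocalRing L v))
      (ht : (t.map (conjLocal L (IsCMField.complexConj L) v))ᵀ * gramS (Fp L) L v 2 (gramR L e dV hdV dW hdW) + gramS (Fp L) L v 2 (gramR L e dV hdV dW hdW) * t = 0)
      (tb : Matrix (Fin (M₂ + M₂)) (Fin (M₂ + M₂)) (LocalRing L v))
      (htb : (tb.map (conjLocal L (IsCMField.complexConj L) v))ᵀ * gramS (Fp L) L v (M₂ + M₂) (UnitaryGroup.finSum M₂ M₂ T₁ T₂) +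
        gramS (Fp L) L v (M₂ + M₂) (UnitaryGroup.finSum M₂ M₂ T₁ T₂) * tb = 0)
      (_hPX : (P : Matrix (Fin (M₂ + M₂)) (Fin (M₂ + M₂)) (Fp L)).map ((UnitaryGroup.toLocalRing L v).comp (algebraMap (Fp L) (v.adicCompletion (Fp L)))) * tb *
        ((P⁻¹ : GL (Fin (M₂ + M₂)) (Fp L)) : Matrix (Fin (M₂ + M₂)) (Fin (M₂ + M₂)) (Fp L)).map
          ((UnitaryGroup.toLocalRing L v).comp (algebraMap (Fp L) (v.adicCompletion (Fp L)))) =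
        Matrix.reindex (epsV e eW e') (epsV e eW e') (t ⊗ₖ (1 : Matrix (Fin M₂) (Fin M₂) (LocalRing L v))))
      (Ψ : SchwartzBruhat (Fin ((M₂ + M₂) + (M₂ + M₂)) → v.adicCompletion (Fp L))),
      swSectionTensorLoc L e dV hdV dW hdW eW e' dV' hdV' v
          (localSplittingDatumCM L v μ (M₂ + M₂)
            (gramR_isSymm L e' dV hdV (tensorFrame L dW eW dV') (tensorFrame_real L dW hdW eW dV' hdV')) hT₀d
            (hermD_eq_map_gramD L e' dV hdV (tensorFrame L dW eW dV') (tensorFrame_real L dW hdW eW dV' hdV')) χ hχ).localSplitting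
          m₀ Ψ
          (w₁ * nElem (Fp L) L (IsCMField.complexConj L) v 2 (T₀ := gramR L e dV hdV dW hdW) (hermD_eq_map_gramD L e dV hdV dW hdW) t ht) =
        c * ∫ x₁ : Fin (M₂ + M₂) → v.adicCompletion (Fp L),
          ((unipOpPi (isLocallyConstant_of_isContinuousNontrivial (isContinuousNontrivial_adeleAddCharAt (Fp L) v))
            (Matrix.mulVecLin (cOfFix (localGram (Fp L) ((M₂ + M₂) + (M₂ + M₂)) (gramD (Fp L) (M₂ + M₂) (UnitaryGroup.finSum M₂ M₂ T₁ T₂)) v)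
              (MpPsi.proj _ (boxLoc (Fp L) v M₂ M₂ (T₁ := T₁) (T₂ := T₂) (p₁, p₂)) *
                iotaD (Fp L) L (IsCMField.complexConj L) (complexConj_imagUnit L) (imagUnit_ne_zero L) (imagUnit_mul_self L) v
                  (M₂ + M₂) (UnitaryGroup.isSymm_finSum hT₁ hT₂) rfl
                  (nElem (Fp L) L (IsCMField.complexConj L) v (M₂ + M₂) (T₀ := UnitaryGroup.finSum M₂ M₂ T₁ T₂) rfl tb htb) *
                (MpPsi.proj _ (boxLoc (Fp L) v M₂ M₂ (T₁ := T₁) (T₂ := T₂) (p₁, p₂)))⁻¹)))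
            (MpPsi.toOp _ (boxLoc (Fp L) v M₂ M₂ (T₁ := T₁) (T₂ := T₂) (p₁, p₂))
              ((frameOp (Fp L) v ((M₂ + M₂) + (M₂ + M₂)) PD).symm Ψ)) :
              SchwartzBruhat (Fin ((M₂ + M₂) + (M₂ + M₂)) → v.adicCompletion (Fp L))) :
            (Fin ((M₂ + M₂) + (M₂ + M₂)) → v.adicCompletion (Fp L)) → ℂ)
            (glue (blkIdx M₂ M₂) x₁ (0 : Fin (M₂ + M₂) → v.adicCompletion (Fp L))) ∂(Measure.pi fun _ => μ) := by
  -- (M2a-C1) at the block datum, outer implementer `frameMp_{PD}⁻¹ m₀` (a mover-implementer by ★ (M1) §1)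
  obtain ⟨c, hc, h⟩ := exists_ne_zero_swSectionLoc_blkLoc_weylDelta_mul_nElem_eq_integral L v μ M₂ M₂ hT₁ hT₂ hT₁d hT₂d χ hχ hM₂' t₁ hT₁t hTv₁
    ((frameMp (Fp L) v ((M₂ + M₂) + (M₂ + M₂)) PD (transpose_pd_mul_gramD_mul_pd (Fp L) (M₂ + M₂) P hP hPD)).symm m₀)
    (map_proj_frameMp_symm_of_mover L dV hdV dW hdW eW e' dV' hdV' v P hP hPD m₀ hm₀) p₁ hp₁ B₁ hW₁ hm p₂ hp₂
  refine ⟨c, hc, fun t ht tb htb hPX Ψ => ?_⟩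
  -- (M1): tensor middle cell = block middle cell through the frame, then (M2a-C1) at `frameOp_{PD}⁻¹ Ψ`
  exact (swSectionTensorLoc_flip_mul_nElem_eq_block L e dV hdV dW hdW eW e' dV' hdV' v μ χ hχ hM₂ hT₀d hi hσ₀ hσ₁ P hPσ hP t' hT' hT₀'d hPD
    m₀ Ψ hw₁ t ht tb htb hPX).trans (h tb htb _)

/-! ## §2 The same integral read through the frame-transported implementer `frameMp_{PD}(j̃(p₁, p₂))` -/

omit [MeasurableSpace (v.adicCompletion (Fp L))] [BorelSpace (v.adicCompletion (Fp L))] in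
/-- `op(j̃) ∘ frameOp_{PD}⁻¹ = frameOp_{PD}⁻¹ ∘ op(frameMp_{PD} j̃)` (★ `toRep_frameMp_apply` read backwards).
[cite: MoeglinVignerasWaldspurger1987, Chap. 2 I.7, II Remarque (3)] -/
theorem toOp_boxLoc_frameOp_symm {T₁ T₂ : Matrix (Fin M₂) (Fin M₂) (Fp L)} (P : GL (Fin (M₂ + M₂)) (Fp L))
    (hP : ((P : Matrix (Fin (M₂ + M₂)) (Fin (M₂ + M₂)) (Fp L)))ᵀ *
        gramR L e' dV hdV (tensorFrame L dW eW dV') (tensorFrame_real L dW hdW eW dV' hdV') * (P : Matrix _ _ (Fp L)) =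
      UnitaryGroup.finSum M₂ M₂ T₁ T₂)
    {PD : GL (Fin ((M₂ + M₂) + (M₂ + M₂))) (Fp L)} (hPD : PD = UnitaryGroup.reindexGL (e₂ (M₂ + M₂)) (UnitaryGroup.blockDiagGL (P, P)))
    (p₁ : LocalMp (Fp L) (M₂ + M₂) (gramD (Fp L) M₂ T₁) v) (p₂ : LocalMp (Fp L) (M₂ + M₂) (gramD (Fp L) M₂ T₂) v)
    (Ψ : SchwartzBruhat (Fin ((M₂ + M₂) + (M₂ + M₂)) → v.adicCompletion (Fp L))) :
    MpPsi.toOp _ (boxLoc (Fp L) v M₂ M₂ (T₁ := T₁) (T₂ := T₂) (p₁, p₂)) ((frameOp (Fp L) v ((M₂ + M₂) + (M₂ + M₂)) PD).symm Ψ) =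
      (frameOp (Fp L) v ((M₂ + M₂) + (M₂ + M₂)) PD).symm (MpPsi.toOp _ (frameMp (Fp L) v ((M₂ + M₂) + (M₂ + M₂)) PD (transpose_pd_mul_gramD_mul_pd (Fp L) (M₂ + M₂) P hP hPD) (boxLoc (Fp L) v M₂ M₂ (T₁ := T₁) (T₂ := T₂) (p₁, p₂))) Ψ) := by
  have h := toRep_frameMp_apply (Fp L) v ((M₂ + M₂) + (M₂ + M₂)) PD (transpose_pd_mul_gramD_mul_pd (Fp L) (M₂ + M₂) P hP hPD)
    (boxLoc (Fp L) v M₂ M₂ (T₁ := T₁) (T₂ := T₂) (p₁, p₂)) ((frameOp (Fp L) v ((M₂ + M₂) + (M₂ + M₂)) PD).symm Ψ)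
  -- `op(frameMp j̃) Ψ = frameOp (op(j̃) (frameOp⁻¹ Ψ))` (`MpPsi.toRep` and `MpPsi.toOp` agree definitionally); no `rw` on the `LocalMp` letters (MEASURED:
  -- `rw … at h` is an `isDefEq` time-out), only `congrArg`∕`Eq.trans`
  have h2 := (congrArg (MpPsi.toRep _ (frameMp (Fp L) v ((M₂ + M₂) + (M₂ + M₂)) PD (transpose_pd_mul_gramD_mul_pd (Fp L) (M₂ + M₂) P hP hPD)
    (boxLoc (Fp L) v M₂ M₂ (T₁ := T₁) (T₂ := T₂) (p₁, p₂)))) ((frameOp (Fp L) v ((M₂ + M₂) + (M₂ + M₂)) PD).apply_symm_apply Ψ)).symm.trans h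
  exact ((congrArg (frameOp (Fp L) v ((M₂ + M₂) + (M₂ + M₂)) PD).symm h2).trans
    ((frameOp (Fp L) v ((M₂ + M₂) + (M₂ + M₂)) PD).symm_apply_apply _)).symm

set_option maxHeartbeats 4000000 in -- MEASURED: 1600000 fails (`whnf` at the `obtain` ∕ `Eq.trans` of §1's instance); as ★ (M2a-C1)
/-- **(M2a-C2b′) THE TENSOR DATUM'S MIDDLE CELL, READ THROUGH `Γ′ := op(frameMp_{PD} j̃(p₁,p₂))`.**  Same data as §1; the integrand is now
`ψ_v(−½⟨y, c_{t′} y⟩) · (Γ′Ψ)(PD·y)` at `y = x₁ ⊔ 0` (`unipOpPi` is the multiplier `ψ_v(−½⟨y, c y⟩)`, ★ `coe_unipOpPi_apply`; `op(j̃)(frameOp⁻¹Ψ) = frameOp⁻¹(Γ′Ψ)`,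
`toOp_boxLoc_frameOp_symm`; `(frameOp⁻¹ f)(y) = f(PD·y)`, ★ `coe_frameOp_symm_apply`).  This is the shape the witness consumes: with `Ψ := Φ_ε` the ★ (H4) witness on
the implementer `(π, op)(frameMp_{PD} j̃)`, `(Γ′Φ_ε) = 𝟙_{κ⁻¹B₁} − 𝟙_{κ⁻¹B₂}` on the nose.
[cite: Kudla1994, §3 Thm. 3.1] [cite: Rangarao1993, Lemma 3.2 (3.8), p. 351] [cite: MoeglinVignerasWaldspurger1987, Chap. 2 I.7, II.1 Rem. (3), (6), II.6] -/
theorem exists_ne_zero_swSectionTensorLoc_flip_mul_nElem_eq_integral_frameMp (hM₂ : 0 < M₂ + M₂)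
    (hT₀d : IsUnit (gramR L e' dV hdV (tensorFrame L dW eW dV') (tensorFrame_real L dW hdW eW dV' hdV')).det)
    {i₀ i₁ : Fin 2} (hi : i₀ ≠ i₁) {σ : Equiv.Perm (Fin (M₂ + M₂))}
    (hσ₀ : ∀ k, σ (epsV e eW e' (i₀, k)) = finSumFinEquiv (Sum.inl k)) (hσ₁ : ∀ k, σ (epsV e eW e' (i₁, k)) = finSumFinEquiv (Sum.inr k))
    {T₁ T₂ : Matrix (Fin M₂) (Fin M₂) (Fp L)}
    (P : GL (Fin (M₂ + M₂)) (Fp L)) (hPσ : (P : Matrix (Fin (M₂ + M₂)) (Fin (M₂ + M₂)) (Fp L)) = σ.toPEquiv.toMatrix)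
    (hP : ((P : Matrix (Fin (M₂ + M₂)) (Fin (M₂ + M₂)) (Fp L)))ᵀ *
        gramR L e' dV hdV (tensorFrame L dW eW dV') (tensorFrame_real L dW hdW eW dV' hdV') * (P : Matrix _ _ (Fp L)) =
      UnitaryGroup.finSum M₂ M₂ T₁ T₂)
    (t' : Fin (M₂ + M₂) → Fp L) (hT' : UnitaryGroup.finSum M₂ M₂ T₁ T₂ = Matrix.diagonal t') (hT₀'d : IsUnit (UnitaryGroup.finSum M₂ M₂ T₁ T₂).det)
    {PD : GL (Fin ((M₂ + M₂) + (M₂ + M₂))) (Fp L)} (hPD : PD = UnitaryGroup.reindexGL (e₂ (M₂ + M₂)) (UnitaryGroup.blockDiagGL (P, P)))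
    (m₀ : LocalMp (Fp L) ((M₂ + M₂) + (M₂ + M₂))
      (gramD (Fp L) (M₂ + M₂) (gramR L e' dV hdV (tensorFrame L dW eW dV') (tensorFrame_real L dW hdW eW dV' hdV'))) v)
    (hm₀ : (deltaLagrangian (Fp L) v (M₂ + M₂)).map (toLin (Fp L) v (MpPsi.proj _ m₀)) = lagrangianY (Fp L) ((M₂ + M₂) + (M₂ + M₂)) v)
    {w₁ : UnitaryGroup.localPi L (IsCMField.complexConj L) (2 + 2) (hermD L e dV hdV dW hdW) v}
    (hw₁ : adapt (matA (Fp L) L (IsCMField.complexConj L) v 2 w₁) =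
      Matrix.fromBlocks (1 - Matrix.single i₀ i₀ 1) (Matrix.single i₀ i₀ 1) (Matrix.single i₀ i₀ 1) (1 - Matrix.single i₀ i₀ 1))
    -- the block data of (M2a-C1)
    (hM₂' : 0 < M₂) (t₁ : Fin M₂ → Fp L) (hT₁t : T₁ = Matrix.diagonal t₁) (hT₁ : T₁.IsSymm) (hT₂ : T₂.IsSymm)
    (hT₁d : IsUnit T₁.det) (hT₂d : IsUnit T₂.det)
    (hTv₁ : IsUnit (localGram (Fp L) (M₂ + M₂) (gramD (Fp L) M₂ T₁) v).det)
    (p₁ : LocalMp (Fp L) (M₂ + M₂) (gramD (Fp L) M₂ T₁) v)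
    (hp₁ : (deltaLagrangian (Fp L) v M₂).map (toLin (Fp L) v (MpPsi.proj _ p₁)) = lagrangianY (Fp L) (M₂ + M₂) v)
    (B₁ : GL (Fin (M₂ + M₂)) (v.adicCompletion (Fp L)))
    (hW₁ : MpPsi.proj _ p₁ * iotaD (Fp L) L (IsCMField.complexConj L) (complexConj_imagUnit L) (imagUnit_ne_zero L)
        (imagUnit_mul_self L) v M₂ hT₁ rfl (weylDelta (Fp L) L (IsCMField.complexConj L) v M₂ (T₀ := T₁) rfl) * (MpPsi.proj _ p₁)⁻¹ =
      (transportSp (localGram (Fp L) (M₂ + M₂) (gramD (Fp L) M₂ T₁) v) hTv₁ (SymplecticGroup.symJ _ _))⁻¹ *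
        transportSp (localGram (Fp L) (M₂ + M₂) (gramD (Fp L) M₂ T₁) v) hTv₁ (levi B₁))
    {m : ℤ} (hm : (adeleAddCharAt (Fp L) v).HasConductorExp m)
    (p₂ : LocalMp (Fp L) (M₂ + M₂) (gramD (Fp L) M₂ T₂) v)
    (hp₂ : (deltaLagrangian (Fp L) v M₂).map (toLin (Fp L) v (MpPsi.proj _ p₂)) = lagrangianY (Fp L) (M₂ + M₂) v) :
    ∃ c : ℂ, c ≠ 0 ∧ ∀ (t : Matrix (Fin 2) (Fin 2) (LocalRing L v))
      (ht : (t.map (conjLocal L (IsCMField.complexConj L) v))ᵀ * gramS (Fp L) L v 2 (gramR L e dV hdV dW hdW) + gramS (Fp L) L v 2 (gramR L e dV hdV dW hdW) * t = 0)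
      (tb : Matrix (Fin (M₂ + M₂)) (Fin (M₂ + M₂)) (LocalRing L v))
      (htb : (tb.map (conjLocal L (IsCMField.complexConj L) v))ᵀ * gramS (Fp L) L v (M₂ + M₂) (UnitaryGroup.finSum M₂ M₂ T₁ T₂) +
        gramS (Fp L) L v (M₂ + M₂) (UnitaryGroup.finSum M₂ M₂ T₁ T₂) * tb = 0)
      (_hPX : (P : Matrix (Fin (M₂ + M₂)) (Fin (M₂ + M₂)) (Fp L)).map ((UnitaryGroup.toLocalRing L v).comp (algebraMap (Fp L) (v.adicCompletion (Fp L)))) * tb *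
        ((P⁻¹ : GL (Fin (M₂ + M₂)) (Fp L)) : Matrix (Fin (M₂ + M₂)) (Fin (M₂ + M₂)) (Fp L)).map
          ((UnitaryGroup.toLocalRing L v).comp (algebraMap (Fp L) (v.adicCompletion (Fp L)))) =
        Matrix.reindex (epsV e eW e') (epsV e eW e') (t ⊗ₖ (1 : Matrix (Fin M₂) (Fin M₂) (LocalRing L v))))
      (Ψ : SchwartzBruhat (Fin ((M₂ + M₂) + (M₂ + M₂)) → v.adicCompletion (Fp L))),
      swSectionTensorLoc L e dV hdV dW hdW eW e' dV' hdV' v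
          (localSplittingDatumCM L v μ (M₂ + M₂)
            (gramR_isSymm L e' dV hdV (tensorFrame L dW eW dV') (tensorFrame_real L dW hdW eW dV' hdV')) hT₀d
            (hermD_eq_map_gramD L e' dV hdV (tensorFrame L dW eW dV') (tensorFrame_real L dW hdW eW dV' hdV')) χ hχ).localSplitting
          m₀ Ψ
          (w₁ * nElem (Fp L) L (IsCMField.complexConj L) v 2 (T₀ := gramR L e dV hdV dW hdW) (hermD_eq_map_gramD L e dV hdV dW hdW) t ht) =
        c * ∫ x₁ : Fin (M₂ + M₂) → v.adicCompletion (Fp L),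
          (adeleAddCharAt (Fp L) v
              (-halfForm (Matrix.mulVecLin (cOfFix (localGram (Fp L) ((M₂ + M₂) + (M₂ + M₂)) (gramD (Fp L) (M₂ + M₂) (UnitaryGroup.finSum M₂ M₂ T₁ T₂)) v)
                (MpPsi.proj _ (boxLoc (Fp L) v M₂ M₂ (T₁ := T₁) (T₂ := T₂) (p₁, p₂)) *
                  iotaD (Fp L) L (IsCMField.complexConj L) (complexConj_imagUnit L) (imagUnit_ne_zero L) (imagUnit_mul_self L) v
                    (M₂ + M₂) (UnitaryGroup.isSymm_finSum hT₁ hT₂) rfl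
                    (nElem (Fp L) L (IsCMField.complexConj L) v (M₂ + M₂) (T₀ := UnitaryGroup.finSum M₂ M₂ T₁ T₂) rfl tb htb) *
                  (MpPsi.proj _ (boxLoc (Fp L) v M₂ M₂ (T₁ := T₁) (T₂ := T₂) (p₁, p₂)))⁻¹)))
                (glue (blkIdx M₂ M₂) x₁ (0 : Fin (M₂ + M₂) → v.adicCompletion (Fp L)))) : ℂ) *
            (((MpPsi.toOp _ (frameMp (Fp L) v ((M₂ + M₂) + (M₂ + M₂)) PD (transpose_pd_mul_gramD_mul_pd (Fp L) (M₂ + M₂) P hP hPD) (boxLoc (Fp L) v M₂ M₂ (T₁ := T₁) (T₂ := T₂) (p₁, p₂))) Ψ :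
                SchwartzBruhat (Fin ((M₂ + M₂) + (M₂ + M₂)) → v.adicCompletion (Fp L))) :
              (Fin ((M₂ + M₂) + (M₂ + M₂)) → v.adicCompletion (Fp L)) → ℂ)
              (frameLin (Fp L) v ((M₂ + M₂) + (M₂ + M₂)) PD (glue (blkIdx M₂ M₂) x₁ (0 : Fin (M₂ + M₂) → v.adicCompletion (Fp L)))))
          ∂(Measure.pi fun _ => μ) := by
  obtain ⟨c, hc, h⟩ := exists_ne_zero_swSectionTensorLoc_flip_mul_nElem_eq_integral L e dV hdV dW hdW eW e' dV' hdV' v μ χ hχ hM₂ hT₀d hi hσ₀ hσ₁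
    P hPσ hP t' hT' hT₀'d hPD m₀ hm₀ hw₁ hM₂' t₁ hT₁t hT₁ hT₂ hT₁d hT₂d hTv₁ p₁ hp₁ B₁ hW₁ hm p₂ hp₂
  refine ⟨c, hc, fun t ht tb htb hPX Ψ => (h t ht tb htb hPX Ψ).trans (congrArg (fun z => c * z) ?_)⟩
  refine integral_congr_ae (Filter.Eventually.of_forall fun x₁ => ?_)
  dsimp only
  rw [coe_unipOpPi_apply, toOp_boxLoc_frameOp_symm L dV hdV dW hdW eW e' dV' hdV' v P hP hPD p₁ p₂ Ψ, coe_frameOp_symm_apply]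


end Summit.HodgeConjecture.HodgeConjecture.Cruxes.HLiu418.K2LiuTensorMiddleCellHaarDelta

end
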